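import Literature.MathematicalPhysics.QuantumFieldTheory.Balaban1983to89.B14Eq16FaddeevPopov
import Literature.MathematicalPhysics.QuantumFieldTheory.Balaban1983to89.B12CriticalPoint23
import Literature.MathematicalPhysics.QuantumFieldTheory.Balaban1983to89.B14Sect3Decomp

/-!
# `Balaban1983to89.B14Eq112Variational` — CMP 119 (1.12) p. 248 WITH BODY (the variational problem defining the first
# background `U₁(Ω₁, V)`: functional `A(U) + 𝐆(Ω₁^{(1)}, U)`, constraints `U = V₀` on `Ω₁ᶜ`, `Ū = V` on `Ω₁^{(1)}`) and the
# p. 248 sentence «It is equal to the critical point of the action A(U) only, on the subspace … satisfying the above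
# conditions and the axial gauge conditions» PROVED (equality of the two sets of minimizers), from gauge invariance of
# `A`, `𝐆 ≥ 0` with `𝐆 = 0` exactly in the block axial gauge, and the EXPLICIT axial-gauge-fixing transformation

statement-level skeleton of published theorems with citation tags; proofs where landed; nothing here is a claim about the Yang–Mills mass gap

CITATION HEADER (lean-in-tree rule).  Source: T. Bałaban, *Convergent renormalization expansions for lattice gauge
theories*, Commun. Math. Phys. **119**, 243–285 (1988), doi:10.1007/bf01217741 [Balaban1988Convergent] (cell paper
B14 = «[III]»; held `paper:balaban1988-cmp119-convergent-renormalization`, journal page = PDF page + 242; p. 248 read on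
the text layer `p0006` and the x2 render `…-p006-x2.png`).  Mega-formalization `lit-balaban`, unit `lit-balaban-r11`
(CMP 119, B14 fold owner), SKELETON row **B14.Eq1.12** (rows B14.Eq1.11 = (1.11), B14.Eq1.13 = (1.13), B11.Thm1 = [15]
Theorem 1; the [I] (2.2)–(2.3) twin is r09's `B12CriticalPoint23`).

THE PRINTED TEXT (p. 248 [PDF 6], verbatim).  *"The next step is again the same as in Sect. A of [16], we make the
translation U = U′U₁ in the integral in (1.11). Let us denote by V₀ the integration variables localized in Ω₁ᶜ, i.e.
V₀ = U|_{Ω₁ᶜ}. The configuration U₁, or more precisely U₁(Ω₁, V), is defined as the critical point of the functional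
  U → A(U) + 𝐆(Ω₁^{(1)}, U)  for  U : U = V₀ on Ω₁ᶜ,  Ū = V on Ω₁^{(1)}.   (1.12)
It is equal to the critical point of the action A(U) only, on the subspace of configurations satisfying the above
conditions and the axial gauge conditions U(y,x) = 1 for x ∈ B(y), x ≠ y, y ∈ Ω₁^{(1)}. By Theorem 1 [15] there exists
exactly one critical point of (1.12) in the domain of integration in (1.11), for ε₀ sufficiently small. It is a minimum of
(1.12), with a strictly positive second order differential."*

THE CARRIERS (pre-existing, BY NAME): fine fields `U : GaugeField P 0 G` on `T_η = T^{(0)}`, coarse fields `V : GaugeField P 1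
G` on `T^{(1)}`, a one-step averaging `Ū = av.avg U` (`Setup.Averaging`, gauge covariant in the standing range `1 ≤ m + K`), the
averaged contour variables `U(y,x) = cd.holTo U y x` ((0.11) [I], `Setup.ContourData`, gauge covariant), `A = Setup.wilsonAction4`,
`𝐆(Y, U) = Setup.gaugeFixFn cd Y U` (1.7), gauge transformations `Setup.GaugeField.gaugeAct`, the residual class `u(y) = 1`
at the block centres (`B12FaddeevPopov016.FineGauge`).  Print's regions enter as parameters: `Y = Ω₁^{(1)} ⊂ T^{(1)}` (a
finite set of coarse sites), `Yb` = the bonds of `Ω₁^{(1)}` (where `Ū = V`), `Bout` = the bonds of `Ω₁ᶜ` (carrying `V₀`).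

READING (declared).  (α) *"critical point"* is read, as print itself continues (*"It is a minimum of (1.12)"*) and as
the cell reads (3.10) (`B14.Sect3Decomp.IsV310`) and [I] (2.2) (`B12CriticalPoint23`, divergence (a) there), as MINIMUM
on the constraint set: `argmin112` = the minimizers of `A + 𝐆(Ω₁^{(1)}, ·)` on `C112`, `argminAx` = the minimizers of `A`
on `C112 ∩ Ax112`; no differential structure on the abstract `G`.  (β) The geometric fact used by the gauge argument —
*the bonds of `Ω₁ᶜ` do not end at a non-central site of a block `B(y)`, `y ∈ Ω₁^{(1)}`* (`B(Ω₁^{(1)}) = Ω₁`) — is the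
hypothesis `hB` on `Bout` (satisfied by the bonds with both ends outside `Ω₁`).  (γ) *"Re tr g = 1 only at g = 1"*
(faithfulness of the normalised trace, true in every `G ⊂ U(N)`, [I] p. 252) is the hypothesis `hG` on the abstract
`Setup.GaugeGroup`, DISCHARGED for `U(N)`, `SU(N)` by r09's `B12CriticalPoint23.eq_one_of_reTr_eq_one_(special)unitaryGroup`.

WHAT IS TYPED / PROVED (0 `sorry`; the definitions are `Set`s and functions, no `Prop`-valued `def`).
§1  **(1.12) WITH BODY**: `F112 cd Y U = A(U) + 𝐆(Y, U)`; `C112 av Bout Yb V₀ V = {U : U = V₀ on Bout, Ū = V on Yb}`; the axial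
    gauge conditions `Ax112 cd Y = {U : U(y,x) = 1, x ∈ B(y), x ≠ y, y ∈ Y}`; `argmin112`, `argminAx`; the translation
    `U = U′U₁` of p. 248 as `U′ = B14.Sect3Decomp.fluct311 U U₁` (`transl_eq`).
§2  THE AXIAL GAUGE FIXING ON `B(Ω₁^{(1)})`, EXPLICIT: `axTransf cd Y U` (`u(x) = U(y,x)` at the non-central sites `x` of the
    blocks `B(y)`, `y ∈ Y`, `u = 1` elsewhere); `fineGauge_axTransf` (`u = 1` at all centres), `gaugeAct_axTransf_mem_Ax`
    (`U^u` satisfies the axial gauge conditions — by the covariance `U^u(y,x) = u(y)U(y,x)u(x)⁻¹` of `Setup.ContourData`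
    alone), `gaugeAct_axTransf_mem_C` (`U^u` keeps the constraints: `Ū^u = Ū` by `B14Eq16FaddeevPopov.avg_gaugeAct_of_fineGauge`,
    `U^u = U` on `Bout` under (β)).
§3  `gaugeFixFn_eq_zero_iff_mem_Ax` (`𝐆(Y,U) = 0 ⇔ U ∈ Ax112 cd Y`, under (γ); `𝐆 ≥ 0` is r09's `gaugeFixFn_nonneg`) and
    **`argmin112_eq_argminAx`** — the p. 248 sentence: the minimizers of `A + 𝐆(Ω₁^{(1)},·)` on the constraint set ARE the
    minimizers of `A` alone on the constraint set cut by the axial gauge conditions (and conversely); `F112_eq_action_of_mem`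
    (at them `𝐆 = 0`, the two minimum values agree); `existsUnique_argmin112_iff` (*"exactly one critical point"* transfers
    between the two formulations); `…_unitaryGroup` / `…_specialUnitaryGroup` forms with (γ) discharged.

NOT ASSERTED: existence / uniqueness of the minimizer, positivity of the second differential (*"By Theorem 1 [15] …"* —
row B11.Thm1, [Balaban1985Variational]); *"in the domain of integration in (1.11)"*, *"for ε₀ sufficiently small"*.

## References
* [Balaban1988Convergent] T. Bałaban, Commun. Math. Phys. 119 (1988) 243–285, (1.11)–(1.13) p. 248.
* [Balaban1985Variational] T. Bałaban, Commun. Math. Phys. 102 (1985) 277–309, Thm 1 p. 279 ([15]).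
* [Balaban1987RG1] T. Bałaban, Commun. Math. Phys. 109 (1987) 249–301, (2.2)–(2.3) p. 265 (the [I] twin).
-/

noncomputable section

namespace Literature.MathematicalPhysics.QuantumFieldTheory.Balaban1983to89.B14.Eq112Variational

open Literature.MathematicalPhysics.QuantumFieldTheory.Balaban1983to89
open B12FaddeevPopov016

variable {P : Params} {G : Type*} [GaugeGroup G]

/-! ## §1  (1.12) WITH BODY -/

/-- **The functional of (1.12)** p. 248: `U ↦ A(U) + 𝐆(Ω₁^{(1)}, U)` (`A = Setup.wilsonAction4`, `𝐆` = (1.7) `Setup.gaugeFixFn` over the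
averaged contour variables `cd`, `Y = Ω₁^{(1)}`). [cite: Balaban1988Convergent, (1.12) p.248] -/
def F112 (cd : ContourData P 0 G) (Y : Finset (Site P 1)) (U : GaugeField P 0 G) : ℝ :=
  wilsonAction4 U + gaugeFixFn cd Y U

/-- **The constraint set of (1.12)** p. 248: *"U : U = V₀ on Ω₁ᶜ, Ū = V on Ω₁^{(1)}"* — `U = V₀` on the bonds `Bout` of `Ω₁ᶜ`
(*"V₀ the integration variables localized in Ω₁ᶜ, i.e. V₀ = U|_{Ω₁ᶜ}"*) and `Ū = av.avg U = V` on the bonds `Yb` of `Ω₁^{(1)}`.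
[cite: Balaban1988Convergent, (1.12) p.248] -/
def C112 (av : Averaging P 0 G) (Bout : Set (PBond P 0)) (Yb : Set (PBond P 1)) (V₀ : GaugeField P 0 G)
    (V : GaugeField P 1 G) : Set (GaugeField P 0 G) :=
  {U | (∀ b ∈ Bout, U b = V₀ b) ∧ ∀ c ∈ Yb, av.avg U c = V c}

/-- **The axial gauge conditions** of p. 248: *"U(y,x) = 1 for x ∈ B(y), x ≠ y, y ∈ Ω₁^{(1)}"* (block axial gauge on the blocks
of `Y = Ω₁^{(1)}`; the all-blocks form is `Setup.AxialGauge`). [cite: Balaban1988Convergent, (1.12) p.248] -/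
def Ax112 (cd : ContourData P 0 G) (Y : Finset (Site P 1)) : Set (GaugeField P 0 G) :=
  {U | ∀ y ∈ Y, ∀ x : Site P 0, blockOf x = y → x ≠ emb y → cd.holTo U y x = 1}

/-- `U₁(Ω₁, V)` *"defined as the critical point of the functional (1.12)"*, READ AS MINIMUM (*"It is a minimum of (1.12)"*):
the set of minimizers of `A + 𝐆(Ω₁^{(1)}, ·)` on the constraint set. [cite: Balaban1988Convergent, (1.12) p.248] -/
def argmin112 (cd : ContourData P 0 G) (Y : Finset (Site P 1)) (av : Averaging P 0 G) (Bout : Set (PBond P 0))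
    (Yb : Set (PBond P 1)) (V₀ : GaugeField P 0 G) (V : GaugeField P 1 G) : Set (GaugeField P 0 G) :=
  {U₁ | U₁ ∈ C112 av Bout Yb V₀ V ∧ IsMinOn (F112 cd Y) (C112 av Bout Yb V₀ V) U₁}

/-- The second formulation of p. 248: *"the critical point of the action A(U) only, on the subspace of configurations satisfying
the above conditions and the axial gauge conditions"* — the minimizers of `A` on `C112 ∩ Ax112`. [cite: Balaban1988Convergent, (1.12) p.248] -/
def argminAx (cd : ContourData P 0 G) (Y : Finset (Site P 1)) (av : Averaging P 0 G) (Bout : Set (PBond P 0))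
    (Yb : Set (PBond P 1)) (V₀ : GaugeField P 0 G) (V : GaugeField P 1 G) : Set (GaugeField P 0 G) :=
  {U₁ | U₁ ∈ C112 av Bout Yb V₀ V ∩ Ax112 cd Y ∧ IsMinOn wilsonAction4 (C112 av Bout Yb V₀ V ∩ Ax112 cd Y) U₁}

/-- p. 248: *"we make the translation U = U′U₁ in the integral in (1.11)"* — the fluctuation configuration `U′ = UU₁⁻¹` bondwise
is the cell's `B14.Sect3Decomp.fluct311 U U₁` ((3.11) at the first step), and `U′U₁ = U`. [cite: Balaban1988Convergent, (1.12)–(1.13) p.248] -/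
theorem transl_eq (U U₁ : GaugeField P 0 G) (b : PBond P 0) : B14.Sect3Decomp.fluct311 U U₁ b * U₁ b = U b := by
  simp [B14.Sect3Decomp.fluct311]

/-! ## §2  The axial gauge fixing on the blocks of `Ω₁^{(1)}`, explicit -/

section AxialFixing

variable (cd : ContourData P 0 G) (Y : Finset (Site P 1))

open Classical in
/-- The gauge transformation that puts `U` into the axial gauge on the blocks `B(y)`, `y ∈ Y`: `u(x) = U(y,x)` at a non-central
site `x ∈ B(y)`, `y ∈ Y`, and `u = 1` elsewhere (in particular at all block centres). [cite: Balaban1988Convergent, (1.12) p.248] -/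
def axTransf (U : GaugeField P 0 G) : GaugeTransf P 0 G :=
  fun x => if blockOf x ∈ Y ∧ x ≠ emb (blockOf x) then cd.holTo U (blockOf x) x else 1

/-- At a non-central site `x` of a block `B(y)`, `y ∈ Y`: `u(x) = U(y,x)`. [cite: Balaban1988Convergent, (1.12) p.248] -/
theorem axTransf_of_inner (U : GaugeField P 0 G) {x : Site P 0} (hY : blockOf x ∈ Y) (hx : x ≠ emb (blockOf x)) :
    axTransf cd Y U x = cd.holTo U (blockOf x) x := by
  classical
  simp [axTransf, hY, hx]

/-- Elsewhere `u(x) = 1`. [cite: Balaban1988Convergent, (1.12) p.248] -/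
theorem axTransf_of_not_inner (U : GaugeField P 0 G) {x : Site P 0} (hx : ¬(blockOf x ∈ Y ∧ x ≠ emb (blockOf x))) :
    axTransf cd Y U x = 1 := by
  classical
  simp only [axTransf, hx, if_false]

/-- `u = 1` at every block centre (standing range `1 ≤ m + K`, where `blockOf ∘ emb = id`): `axTransf` is a residual (fine) gauge
transformation in the sense of [I] p. 254 (`FineGauge`). [cite: Balaban1988Convergent, (1.12) p.248] -/
theorem fineGauge_axTransf (h01 : 0 + 1 ≤ P.m + P.K) (U : GaugeField P 0 G) : FineGauge (axTransf cd Y U) := by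
  intro y
  apply axTransf_of_not_inner
  rw [Site.blockOf_emb h01 y]
  exact fun h => h.2 rfl

/-- **`U^u` satisfies the axial gauge conditions** on the blocks of `Y`: `U^u(y,x) = u(y)U(y,x)u(x)⁻¹ = 1·U(y,x)·U(y,x)⁻¹ = 1` for
`x ∈ B(y)`, `x ≠ y`, `y ∈ Y` — from the gauge covariance of the contour variables (`Setup.ContourData.covariant`) alone.
[cite: Balaban1988Convergent, (1.12) p.248] -/
theorem gaugeAct_axTransf_mem_Ax (h01 : 0 + 1 ≤ P.m + P.K) (U : GaugeField P 0 G) :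
    GaugeField.gaugeAct (axTransf cd Y U) U ∈ Ax112 cd Y := by
  intro y hy x hxy hx
  rw [cd.covariant, fineGauge_axTransf cd Y h01 U y, one_mul]
  subst hxy
  rw [axTransf_of_inner cd Y U hy hx, mul_inv_cancel]

/-- `U^u = U` on every bond whose two ends are not non-central sites of the blocks of `Y` (there `u = 1`).
[cite: Balaban1988Convergent, (1.12) p.248] -/
theorem gaugeAct_axTransf_apply_of_not_inner (U : GaugeField P 0 G) {b : PBond P 0}
    (hs : ¬(blockOf b.src ∈ Y ∧ b.src ≠ emb (blockOf b.src))) (ht : ¬(blockOf b.tgt ∈ Y ∧ b.tgt ≠ emb (blockOf b.tgt))) :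
    GaugeField.gaugeAct (axTransf cd Y U) U b = U b := by
  simp only [GaugeField.gaugeAct, axTransf_of_not_inner cd Y U hs, axTransf_of_not_inner cd Y U ht, one_mul, inv_one, mul_one]

/-- **`U^u` keeps the constraints of (1.12)**: `Ū^u = Ū` because `u = 1` at the centres (gauge covariance of `Setup.Averaging`,
`B14Eq16FaddeevPopov.avg_gaugeAct_of_fineGauge`), and `U^u = U = V₀` on the bonds of `Ω₁ᶜ`, which do not end at non-central
sites of the blocks `B(y)`, `y ∈ Ω₁^{(1)}` (hypothesis `hB`; `B(Ω₁^{(1)}) = Ω₁`). [cite: Balaban1988Convergent, (1.12) p.248] -/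
theorem gaugeAct_axTransf_mem_C (h01 : 0 + 1 ≤ P.m + P.K) (av : Averaging P 0 G) {Bout : Set (PBond P 0)}
    (hB : ∀ b ∈ Bout, ¬(blockOf b.src ∈ Y ∧ b.src ≠ emb (blockOf b.src)) ∧ ¬(blockOf b.tgt ∈ Y ∧ b.tgt ≠ emb (blockOf b.tgt)))
    (Yb : Set (PBond P 1)) (V₀ : GaugeField P 0 G) (V : GaugeField P 1 G) {U : GaugeField P 0 G}
    (hU : U ∈ C112 av Bout Yb V₀ V) : GaugeField.gaugeAct (axTransf cd Y U) U ∈ C112 av Bout Yb V₀ V := by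
  refine ⟨fun b hb => ?_, fun c hc => ?_⟩
  · rw [gaugeAct_axTransf_apply_of_not_inner cd Y U (hB b hb).1 (hB b hb).2]
    exact hU.1 b hb
  · rw [B14Eq16FaddeevPopov.avg_gaugeAct_of_fineGauge h01 av (fineGauge_axTransf cd Y h01 U) U]
    exact hU.2 c hc

end AxialFixing

/-! ## §3  «It is equal to the critical point of the action A(U) only, on the subspace … and the axial gauge conditions» -/

section Claim

variable (cd : ContourData P 0 G) (Y : Finset (Site P 1))

/-- `𝐆(Y, U) = 0` exactly when `U` satisfies the axial gauge conditions on the blocks of `Y` (every term `1 − Re tr U(y,x) ≥ 0`, and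
`= 0` iff `U(y,x) = 1` under the faithfulness `hG` of the normalised trace). [cite: Balaban1988Convergent, (1.7) p.247, (1.12) p.248] -/
theorem gaugeFixFn_eq_zero_iff_mem_Ax (hG : ∀ g : G, reTr g = 1 → g = 1) (U : GaugeField P 0 G) :
    gaugeFixFn cd Y U = 0 ↔ U ∈ Ax112 cd Y := by
  have hterm : ∀ (y : Site P 1) (x : Site P 0), 0 ≤ 1 - reTr (cd.holTo U y x) := fun y x => by
    have := GaugeGroup.reTr_le_one (cd.holTo U y x); linarith
  constructor
  · intro h y hy x hxy hx
    unfold gaugeFixFn at h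
    have hy0 : ∑ x ∈ (block y).erase (emb y), (1 - reTr (cd.holTo U y x)) = 0 :=
      (Finset.sum_eq_zero_iff_of_nonneg fun y' _ => Finset.sum_nonneg fun x' _ => hterm y' x').1 h y hy
    have hmem : x ∈ (block y).erase (emb y) := by
      rw [Finset.mem_erase]
      exact ⟨hx, Finset.mem_filter.2 ⟨Finset.mem_univ _, hxy⟩⟩
    have hx0 : 1 - reTr (cd.holTo U y x) = 0 := (Finset.sum_eq_zero_iff_of_nonneg fun x' _ => hterm y x').1 hy0 x hmem
    exact hG _ (by linarith)
  · intro h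
    unfold gaugeFixFn
    refine Finset.sum_eq_zero fun y hy => Finset.sum_eq_zero fun x hx => ?_
    rw [Finset.mem_erase] at hx
    have hb : blockOf x = y := (Finset.mem_filter.1 hx.2).2
    rw [h y hy x hb hx.1, GaugeGroup.reTr_one, sub_self]

/-- Membership in `argmin112`, unfolded. [cite: Balaban1988Convergent, (1.12) p.248] -/
theorem mem_argmin112_iff (av : Averaging P 0 G) (Bout : Set (PBond P 0)) (Yb : Set (PBond P 1))
    (V₀ : GaugeField P 0 G) (V : GaugeField P 1 G) (U₁ : GaugeField P 0 G) :
    U₁ ∈ argmin112 cd Y av Bout Yb V₀ V ↔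
      U₁ ∈ C112 av Bout Yb V₀ V ∧ ∀ U ∈ C112 av Bout Yb V₀ V, F112 cd Y U₁ ≤ F112 cd Y U := by
  rw [← isMinOn_iff]; exact Iff.rfl

/-- Membership in `argminAx`, unfolded. [cite: Balaban1988Convergent, (1.12) p.248] -/
theorem mem_argminAx_iff (av : Averaging P 0 G) (Bout : Set (PBond P 0)) (Yb : Set (PBond P 1))
    (V₀ : GaugeField P 0 G) (V : GaugeField P 1 G) (U₁ : GaugeField P 0 G) :
    U₁ ∈ argminAx cd Y av Bout Yb V₀ V ↔
      U₁ ∈ C112 av Bout Yb V₀ V ∩ Ax112 cd Y ∧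
        ∀ U ∈ C112 av Bout Yb V₀ V ∩ Ax112 cd Y, wilsonAction4 U₁ ≤ wilsonAction4 U := by
  rw [← isMinOn_iff]; exact Iff.rfl

/-- **The p. 248 sentence, PROVED**: *"[The critical point of (1.12)] is equal to the critical point of the action A(U) only, on the
subspace of configurations satisfying the above conditions and the axial gauge conditions U(y,x) = 1 for x ∈ B(y), x ≠ y, y ∈
Ω₁^{(1)}"* — in the minimum reading: the minimizers of `A + 𝐆(Ω₁^{(1)}, ·)` on the constraint set `C112` ARE EXACTLY the minimizers
of `A` on `C112 ∩ Ax112`.  PROOF: `A` is gauge invariant, `𝐆 ≥ 0` vanishes exactly in the axial gauge, and every `U ∈ C112` is gauge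
equivalent inside `C112` to `U^u ∈ Ax112` (§2): a minimizer `U₁` of `A + 𝐆` has `A(U₁) + 𝐆(U₁) ≤ A(U₁^u) = A(U₁)`, so `𝐆(U₁) =
0`; conversely for `U₁ ∈ argminAx` and `U ∈ C112`, `A(U) + 𝐆(U) ≥ A(U) = A(U^u) ≥ A(U₁) = A(U₁) + 𝐆(U₁)`.  Hypotheses: the standing
range `1 ≤ m + K`, the trace faithfulness `hG` (γ), the bond hypothesis `hB` (β). [cite: Balaban1988Convergent, (1.12) p.248] -/
theorem argmin112_eq_argminAx (h01 : 0 + 1 ≤ P.m + P.K) (hG : ∀ g : G, reTr g = 1 → g = 1) (av : Averaging P 0 G)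
    {Bout : Set (PBond P 0)}
    (hB : ∀ b ∈ Bout, ¬(blockOf b.src ∈ Y ∧ b.src ≠ emb (blockOf b.src)) ∧ ¬(blockOf b.tgt ∈ Y ∧ b.tgt ≠ emb (blockOf b.tgt)))
    (Yb : Set (PBond P 1)) (V₀ : GaugeField P 0 G) (V : GaugeField P 1 G) :
    argmin112 cd Y av Bout Yb V₀ V = argminAx cd Y av Bout Yb V₀ V := by
  ext U₁
  rw [mem_argmin112_iff, mem_argminAx_iff]
  have hA : ∀ U : GaugeField P 0 G, wilsonAction4 (GaugeField.gaugeAct (axTransf cd Y U) U) = wilsonAction4 U :=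
    fun U => B14Eq16FaddeevPopov.wilsonAction4_gaugeAct' _ U
  have hG0 := B12CriticalPoint23.gaugeFixFn_nonneg cd Y
  have hzero : ∀ U : GaugeField P 0 G, U ∈ Ax112 cd Y → gaugeFixFn cd Y U = 0 := fun U h =>
    (gaugeFixFn_eq_zero_iff_mem_Ax cd Y hG U).2 h
  constructor
  · rintro ⟨hC, hmin⟩
    -- `𝐆(U₁) = 0`: compare with the gauge-fixed `U₁^u ∈ C112 ∩ Ax112`
    have hfixC := gaugeAct_axTransf_mem_C cd Y h01 av hB Yb V₀ V hC
    have hfixAx := gaugeAct_axTransf_mem_Ax cd Y h01 U₁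
    have h1 := hmin _ hfixC
    unfold F112 at h1
    rw [hA U₁, hzero _ hfixAx, add_zero] at h1
    have hGU₁ : gaugeFixFn cd Y U₁ = 0 := le_antisymm (by linarith) (hG0 U₁)
    refine ⟨⟨hC, (gaugeFixFn_eq_zero_iff_mem_Ax cd Y hG U₁).1 hGU₁⟩, fun U hU => ?_⟩
    have h2 := hmin U hU.1
    unfold F112 at h2
    rw [hGU₁, hzero U hU.2, add_zero, add_zero] at h2
    exact h2
  · rintro ⟨⟨hC, hAx⟩, hmin⟩
    refine ⟨hC, fun U hU => ?_⟩
    have hfixC := gaugeAct_axTransf_mem_C cd Y h01 av hB Yb V₀ V hU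
    have hfixAx := gaugeAct_axTransf_mem_Ax cd Y h01 U
    have h1 := hmin _ ⟨hfixC, hfixAx⟩
    rw [hA U] at h1
    unfold F112
    rw [hzero U₁ hAx, add_zero]
    linarith [hG0 U]

/-- At a minimizer of (1.12) the gauge-fixing term vanishes: the two minimum values agree, `A(U₁) + 𝐆(Ω₁^{(1)}, U₁) = A(U₁)`.
[cite: Balaban1988Convergent, (1.12) p.248] -/
theorem F112_eq_action_of_mem (h01 : 0 + 1 ≤ P.m + P.K) (hG : ∀ g : G, reTr g = 1 → g = 1) (av : Averaging P 0 G)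
    {Bout : Set (PBond P 0)}
    (hB : ∀ b ∈ Bout, ¬(blockOf b.src ∈ Y ∧ b.src ≠ emb (blockOf b.src)) ∧ ¬(blockOf b.tgt ∈ Y ∧ b.tgt ≠ emb (blockOf b.tgt)))
    (Yb : Set (PBond P 1)) (V₀ : GaugeField P 0 G) (V : GaugeField P 1 G) {U₁ : GaugeField P 0 G}
    (hU₁ : U₁ ∈ argmin112 cd Y av Bout Yb V₀ V) : F112 cd Y U₁ = wilsonAction4 U₁ := by
  rw [argmin112_eq_argminAx cd Y h01 hG av hB Yb V₀ V] at hU₁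
  rw [F112, (gaugeFixFn_eq_zero_iff_mem_Ax cd Y hG U₁).2 hU₁.1.2, add_zero]

/-- *"there exists exactly one critical point of (1.12)"* ([15] Thm 1, NOT proved here) reads the same in both formulations: the
minimizer of `A + 𝐆` on the constraint set is unique iff the minimizer of `A` on the constraint set in the axial gauge is, and it
is the same configuration. [cite: Balaban1988Convergent, (1.12) p.248] -/
theorem existsUnique_argmin112_iff (h01 : 0 + 1 ≤ P.m + P.K) (hG : ∀ g : G, reTr g = 1 → g = 1) (av : Averaging P 0 G)
    {Bout : Set (PBond P 0)}
    (hB : ∀ b ∈ Bout, ¬(blockOf b.src ∈ Y ∧ b.src ≠ emb (blockOf b.src)) ∧ ¬(blockOf b.tgt ∈ Y ∧ b.tgt ≠ emb (blockOf b.tgt)))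
    (Yb : Set (PBond P 1)) (V₀ : GaugeField P 0 G) (V : GaugeField P 1 G) :
    (∃! U₁, U₁ ∈ argmin112 cd Y av Bout Yb V₀ V) ↔ ∃! U₁, U₁ ∈ argminAx cd Y av Bout Yb V₀ V := by
  rw [argmin112_eq_argminAx cd Y h01 hG av hB Yb V₀ V]

/-- The bond hypothesis (β) holds for the bonds with both ends outside the blocks of `Y` — print's `Ω₁ᶜ` with `B(Ω₁^{(1)}) = Ω₁`.
[cite: Balaban1988Convergent, (1.12) p.248] -/
theorem bout_hyp_of_blocks_not_mem {Bout : Set (PBond P 0)} (h : ∀ b ∈ Bout, blockOf b.src ∉ Y ∧ blockOf b.tgt ∉ Y) :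
    ∀ b ∈ Bout, ¬(blockOf b.src ∈ Y ∧ b.src ≠ emb (blockOf b.src)) ∧ ¬(blockOf b.tgt ∈ Y ∧ b.tgt ≠ emb (blockOf b.tgt)) :=
  fun b hb => ⟨fun h' => (h b hb).1 h'.1, fun h' => (h b hb).2 h'.1⟩

end Claim

/-! ## §4  The unitary instances: (γ) discharged -/

section Unitary

open Literature.MathematicalPhysics.QuantumLattice
open scoped Matrix.Norms.L2Operator

variable {P : Params} {n : Type*} [DecidableEq n] [Fintype n] [Nonempty n]

/-- The p. 248 sentence for `G = U(n)` (the faithfulness of the normalised trace discharged by r09's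
`B12CriticalPoint23.eq_one_of_reTr_eq_one_unitaryGroup`). [cite: Balaban1988Convergent, (1.12) p.248] -/
theorem argmin112_eq_argminAx_unitaryGroup (h01 : 0 + 1 ≤ P.m + P.K) (cd : ContourData P 0 (Matrix.unitaryGroup n ℂ))
    (Y : Finset (Site P 1)) (av : Averaging P 0 (Matrix.unitaryGroup n ℂ)) {Bout : Set (PBond P 0)}
    (hB : ∀ b ∈ Bout, ¬(blockOf b.src ∈ Y ∧ b.src ≠ emb (blockOf b.src)) ∧ ¬(blockOf b.tgt ∈ Y ∧ b.tgt ≠ emb (blockOf b.tgt)))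
    (Yb : Set (PBond P 1)) (V₀ : GaugeField P 0 (Matrix.unitaryGroup n ℂ)) (V : GaugeField P 1 (Matrix.unitaryGroup n ℂ)) :
    argmin112 cd Y av Bout Yb V₀ V = argminAx cd Y av Bout Yb V₀ V :=
  argmin112_eq_argminAx cd Y h01 B12CriticalPoint23.eq_one_of_reTr_eq_one_unitaryGroup av hB Yb V₀ V

/-- The p. 248 sentence for `G = SU(n)`. [cite: Balaban1988Convergent, (1.12) p.248] -/
theorem argmin112_eq_argminAx_specialUnitaryGroup (h01 : 0 + 1 ≤ P.m + P.K)
    (cd : ContourData P 0 (Matrix.specialUnitaryGroup n ℂ)) (Y : Finset (Site P 1))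
    (av : Averaging P 0 (Matrix.specialUnitaryGroup n ℂ)) {Bout : Set (PBond P 0)}
    (hB : ∀ b ∈ Bout, ¬(blockOf b.src ∈ Y ∧ b.src ≠ emb (blockOf b.src)) ∧ ¬(blockOf b.tgt ∈ Y ∧ b.tgt ≠ emb (blockOf b.tgt)))
    (Yb : Set (PBond P 1)) (V₀ : GaugeField P 0 (Matrix.specialUnitaryGroup n ℂ))
    (V : GaugeField P 1 (Matrix.specialUnitaryGroup n ℂ)) :
    argmin112 cd Y av Bout Yb V₀ V = argminAx cd Y av Bout Yb V₀ V :=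
  argmin112_eq_argminAx cd Y h01 B12CriticalPoint23.eq_one_of_reTr_eq_one_specialUnitaryGroup av hB Yb V₀ V

end Unitary

end Literature.MathematicalPhysics.QuantumFieldTheory.Balaban1983to89.B14.Eq112Variational
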